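import Summits.KontsevichZagierPeriods.KontsevichZagierPeriods.Theorems.SoloInformedCurveSectorPoly

/-!
# Weights rational in one variable enter the curve sector by a polynomial stretch (Theorem XVI-Q)

Solo programme `solo-KontsevichZagierPeriods-informed`, session s32, line "the curve sector".
Companion to `SoloInformedCurveSectorPoly.lean` (Theorem XVI-P: `[D, p]`, `p ∈ ℚ[x, y]`,
`D ⊆ ℝ²` bounded, has `Per` in `soloInformedKappaSpan`).

* `soloInformed_of_sub_of_mem_relations_polyMap` — rule (2) of [KZ 2001, §1.2] for a polynomial
  map with rational coefficients, packaged over the symbolic Jacobian of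
  `SoloInformedPolyJacobian.lean`.
* `soloInformed_per_mem_span_div` — **THEOREM XVI-Q.** For `r = [D, q(x, y) / d(y)]` with `D ⊆ ℝ²`
  bounded `ℚ`-semialgebraic, `q ∈ ℚ[x, y]`, `d ∈ ℚ[y]` and `d ≥ δ > 0` on `D`,
  `Per r ∈ soloInformedKappaSpan`. Proof: the polynomial stretch `Θ(ξ, y) = (ξ·d(y), y)` has
  Jacobian `d(y) > 0` and is a bijection of `{d ≠ 0}`; rule (2) gives
  `[Θ⁻¹(D), q(Θ(ξ, y))] ≡ [D, q / d]`, and the left side is a polynomially weighted bounded planar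
  integral (Theorem XVI-P).

This is the planar input of Theorem XVII (`SoloInformedCurveSectorRevolution.lean`: solids of
revolution with polynomial radius-squared profile, in particular the unit ball, are in the curve
sector), where the weight `2 q(x) / (1 + t²)` appears as the fibre length after the rational
half-angle substitution.

References: M. Kontsevich, D. Zagier, *Periods* (2001), §1.2, rules (1)–(2) [KontsevichZagier2001].
-/

noncomputable section

open MeasureTheory Set
open Literature.ModelTheory.ExponentialFields Literature.NumberTheory.Transcendental
open Literature.NumberTheory.Transcendental.KZ

namespace Summit.KontsevichZagierPeriods.KontsevichZagierPeriods.Theorems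

/-! ## 1. Rule (2) for polynomial maps, packaged -/

/-- **Rule (2) for a polynomial map with rational coefficients.** If `Φ = κ_P` is injective on
`r.domain`, `r'.domain = Φ(r.domain)` and `r.integrand = (r'.integrand ∘ Φ) · |det J_P|` on
`r.domain`, then `[r] − [r'] ∈ relations`. [Kontsevich–Zagier 2001, §1.2, rule (2)] -/
theorem soloInformed_of_sub_of_mem_relations_polyMap {n : ℕ} (P : Fin n → MvPolynomial (Fin n) ℚ)
    (r r' : IntegralRep n) (hinj : InjOn (soloInformedPolyMap P) r.domain)
    (hdom : r'.domain = soloInformedPolyMap P '' r.domain)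
    (hint : ∀ x ∈ r.domain, r.integrand x = r'.integrand (soloInformedPolyMap P x) *
      |(MvPolynomial.aeval x (soloInformedJacMat P).det : ℝ)|) :
    of r - of r' ∈ relations :=
  changeOfVariablesRel_subset_relations ⟨n, r, r', soloInformedPolyMap P, soloInformedJacCLM P,
    isSemialgebraicMapOn_aeval r.isSemialgebraic_domain P,
    fun u _ => (soloInformed_hasFDerivAt_polyMap P u).hasFDerivWithinAt, hinj, hdom,
    fun x hx => by rw [hint x hx, soloInformed_det_jacCLM], rfl⟩

/-- A polynomial in the single variable `X j` has vanishing partial derivative in `X i`, `i ≠ j`. -/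
theorem soloInformed_pderiv_rename_of_ne {σ : Type*} {m : ℕ} {i j : Fin m} (h : j ≠ i)
    (d : MvPolynomial σ ℚ) :
    MvPolynomial.pderiv i (MvPolynomial.rename (fun _ : σ => j) d) = 0 := by
  induction d using MvPolynomial.induction_on with
  | C a => simp
  | add p q hp hq => simp [hp, hq]
  | mul_X p k hp => simp [hp, MvPolynomial.pderiv_X_of_ne h]

/-- Evaluating a renamed one-variable polynomial reads off one coordinate. -/
theorem soloInformed_aeval_rename_const {m : ℕ} (j : Fin m) (d : MvPolynomial (Fin 1) ℚ)
    (w : Fin m → ℝ) :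
    (MvPolynomial.aeval w (MvPolynomial.rename (fun _ : Fin 1 => j) d) : ℝ) =
      MvPolynomial.aeval (fun _ : Fin 1 => w j) d := by
  rw [MvPolynomial.aeval_rename]
  rfl

/-! ## 2. The polynomial stretch `Θ(ξ, y) = (ξ·d(y), y)` -/

/-- First component of the stretch. -/
theorem soloInformed_stretch_apply_zero (d : MvPolynomial (Fin 1) ℚ) (w : Fin 2 → ℝ) :
    soloInformedPolyMap ![MvPolynomial.X 0 * MvPolynomial.rename (fun _ : Fin 1 => (1 : Fin 2)) d,
      MvPolynomial.X 1] w 0 = w 0 * MvPolynomial.aeval (fun _ : Fin 1 => w 1) d := by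
  simp [soloInformedPolyMap, soloInformed_aeval_rename_const]

/-- Second component of the stretch. -/
theorem soloInformed_stretch_apply_one (d : MvPolynomial (Fin 1) ℚ) (w : Fin 2 → ℝ) :
    soloInformedPolyMap ![MvPolynomial.X 0 * MvPolynomial.rename (fun _ : Fin 1 => (1 : Fin 2)) d,
      MvPolynomial.X 1] w 1 = w 1 := by
  simp [soloInformedPolyMap]

/-- **The Jacobian of the stretch is `d(y)`.** -/
theorem soloInformed_det_stretchY (d : MvPolynomial (Fin 1) ℚ) (w : Fin 2 → ℝ) :
    (MvPolynomial.aeval w (soloInformedJacMat ![MvPolynomial.X 0 *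
      MvPolynomial.rename (fun _ : Fin 1 => (1 : Fin 2)) d, MvPolynomial.X 1]).det : ℝ) =
      MvPolynomial.aeval (fun _ : Fin 1 => w 1) d := by
  rw [Matrix.det_fin_two]
  simp [soloInformedJacMat_apply, MvPolynomial.pderiv_X,
    soloInformed_pderiv_rename_of_ne (show (1 : Fin 2) ≠ 0 by decide),
    soloInformed_aeval_rename_const]

/-! ## 3. THEOREM XVI-Q — weights `q(x, y) / d(y)` -/

/-- **THEOREM XVI-Q.** For a representation `r = [D, q / d]` of dimension two with `D` bounded
(`ℚ`-semialgebraic), `q ∈ ℚ[x, y]`, `d ∈ ℚ[y]` a polynomial in the second variable alone with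
`d ≥ δ > 0` on `D`, `Per r` lies in the curve sector: the stretch `Θ(ξ, y) = (ξ·d(y), y)` pulls
`[D, q / d]` back to the polynomially weighted `[Θ⁻¹(D), q ∘ Θ]` (rule (2)), which is in the sector
by Theorem XVI-P. [Kontsevich–Zagier 2001, §1.2, rule (2)] -/
theorem soloInformed_per_mem_span_div (r : IntegralRep 2) (hb : Bornology.IsBounded r.domain)
    (q : MvPolynomial (Fin 2) ℚ) (d : MvPolynomial (Fin 1) ℚ) {δ : ℝ} (hδ : 0 < δ)
    (hd : ∀ z ∈ r.domain, δ ≤ MvPolynomial.aeval (fun _ : Fin 1 => z 1) d)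
    (hr : ∀ z ∈ r.domain, r.integrand z =
      MvPolynomial.aeval z q / MvPolynomial.aeval (fun _ : Fin 1 => z 1) d) :
    soloInformedPer r ∈ soloInformedKappaSpan := by
  classical
  set Θ : Fin 2 → MvPolynomial (Fin 2) ℚ := ![MvPolynomial.X 0 *
    MvPolynomial.rename (fun _ : Fin 1 => (1 : Fin 2)) d, MvPolynomial.X 1] with hΘ
  have hΘ0 : ∀ w, soloInformedPolyMap Θ w 0 = w 0 * MvPolynomial.aeval (fun _ : Fin 1 => w 1) d :=
    soloInformed_stretch_apply_zero d
  have hΘ1 : ∀ w, soloInformedPolyMap Θ w 1 = w 1 := soloInformed_stretch_apply_one d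
  -- the pulled-back domain `E = Θ⁻¹(D)` is `ℚ`-semialgebraic and bounded
  set E : Set (Fin 2 → ℝ) := soloInformedPolyMap Θ ⁻¹' r.domain with hE
  have hEsa : IsSemialgebraic ℚ E := r.isSemialgebraic_domain.preimage_aeval Θ
  have hdE : ∀ w ∈ E, δ ≤ MvPolynomial.aeval (fun _ : Fin 1 => w 1) d := fun w hw => by
    have h := hd _ hw
    rwa [hΘ1] at h
  obtain ⟨R, hR0, hR⟩ := soloInformed_exists_abs_le_of_isBounded hb
  have hEbox : E ⊆ {w : Fin 2 → ℝ | ∀ i, |w i| ≤ max R (R / δ)} := by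
    intro w hw i
    have hdw := hdE w hw
    have hdpos : 0 < (MvPolynomial.aeval (fun _ : Fin 1 => w 1) d : ℝ) := hδ.trans_le hdw
    fin_cases i
    · refine le_trans ?_ (le_max_right _ _)
      have h0 := hR _ hw 0
      rw [hΘ0, abs_mul, abs_of_pos hdpos] at h0
      rw [le_div_iff₀ hδ]
      calc |w 0| * δ ≤ |w 0| * MvPolynomial.aeval (fun _ : Fin 1 => w 1) d :=
            mul_le_mul_of_nonneg_left hdw (abs_nonneg _)
        _ ≤ R := h0
    · refine le_trans ?_ (le_max_left _ _)
      have h1 := hR _ hw 1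
      rwa [hΘ1] at h1
  have hEb : Bornology.IsBounded E := (soloInformed_isCompact_box _).isBounded.subset hEbox
  -- the pulled-back representation `[E, q ∘ Θ]`
  set p₀ : MvPolynomial (Fin 2) ℚ := MvPolynomial.bind₁ Θ q with hp₀
  have hp₀eval : ∀ w : Fin 2 → ℝ, (MvPolynomial.aeval w p₀ : ℝ) =
      MvPolynomial.aeval (soloInformedPolyMap Θ w) q := fun w => by
    rw [hp₀, MvPolynomial.aeval_bind₁]
    rfl
  let r₀ : IntegralRep 2 := ⟨E, fun w => (MvPolynomial.aeval w p₀ : ℝ), hEsa,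
    isSemialgebraicFunOn_aeval hEsa p₀,
    ((soloInformed_continuous_aeval_of_hasFDerivAt p₀).continuousOn.integrableOn_compact
      (soloInformed_isCompact_box _)).mono_set hEbox⟩
  -- rule (2) along `Θ`
  have hinj : InjOn (soloInformedPolyMap Θ) E := by
    intro w hw w' hw' hww
    have h1 : w 1 = w' 1 := by simpa only [hΘ1] using congr_fun hww 1
    have h0 := congr_fun hww 0
    rw [hΘ0, hΘ0, ← h1] at h0
    have hdpos : 0 < (MvPolynomial.aeval (fun _ : Fin 1 => w 1) d : ℝ) := hδ.trans_le (hdE w hw)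
    have h0' : w 0 = w' 0 := mul_right_cancel₀ hdpos.ne' h0
    ext i
    fin_cases i
    · exact h0'
    · exact h1
  have hdom : r.domain = soloInformedPolyMap Θ '' E := by
    refine (image_preimage_eq_of_subset fun z hz => ?_).symm
    have hdpos : 0 < (MvPolynomial.aeval (fun _ : Fin 1 => z 1) d : ℝ) := hδ.trans_le (hd z hz)
    refine ⟨![z 0 / MvPolynomial.aeval (fun _ : Fin 1 => z 1) d, z 1], ?_⟩
    ext i
    fin_cases i
    · show soloInformedPolyMap Θ _ 0 = z 0
      rw [hΘ0]
      simp only [Matrix.cons_val_zero, Matrix.cons_val_one]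
      exact div_mul_cancel₀ _ hdpos.ne'
    · show soloInformedPolyMap Θ _ 1 = z 1
      rw [hΘ1]
      simp
  have hrel : of r₀ - of r ∈ relations := by
    refine soloInformed_of_sub_of_mem_relations_polyMap Θ r₀ r hinj hdom fun w hw => ?_
    have hdpos : 0 < (MvPolynomial.aeval (fun _ : Fin 1 => w 1) d : ℝ) := hδ.trans_le (hdE w hw)
    show (MvPolynomial.aeval w p₀ : ℝ) = _
    rw [hr _ hw, soloInformed_det_stretchY, hΘ1, abs_of_pos hdpos, hp₀eval,
      div_mul_cancel₀ _ hdpos.ne']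
  rw [← soloInformedPer_congr hrel]
  exact soloInformed_per_mem_span_poly r₀ hEb p₀ fun w _ => rfl

end Summit.KontsevichZagierPeriods.KontsevichZagierPeriods.Theorems
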